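import Literature.Computability.FineGrained.CliqueETHReductionProgram
import Literature.Computability.FineGrained.CliqueETH
import HarnessLib

/-!
# ETH-hardness of `k`-Clique: the grouping reduction on the word RAM (proof of the named fact)

The proof of the named fact `sparseKSATInRAMTime_of_kCliqueInTimeNLittleOK` of
`…FineGrained.CliqueETH` (Chen–Huang–Kanj–Xia, JCSS 72 (2006), Lemma 2.2 and Thm. 5.5, read on
the word RAM): if `k`-Clique has an `f(k) · N^{o(k)}`-time deterministic word-RAM algorithm
(`KCliqueInTimeNLittleOK`), then for every density `c` and every `δ > 0` sparse 3-SAT is decided in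
word-RAM time `O(2^{δ n})` (`SparseKSATInRAMTime 3 c δ`). With the build of
`…CliqueETHReductionProgram` in hand, this file supplies

* **the run** (`Params.reduction_outputsWithin`): the emulator's side conditions for the reduction's
  layout (`Params.envOK`), the target invariant and the agreement of the emulated memory with the
  initial memory of the clique program on the position instance at the end of the build
  (`Params.tinv_finMem`, `Params.agree_finMem`), the read-out (`Params.post_spec`), whence, by
  `SProg.outputsWithin_withSubrun`, the reduction program outputs the clique program's answer bit
  — `[1]` iff `φ` is satisfiable, by `hasKClique_posInstance_iff` — within `Tpre + 38 T + 4` steps;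
* **the word size** (`Params.kfit`,
  `Params.fits`): at `W = kfit · (n + inputWidth x)` everything fits,
  for formulas with `m ≤ c n` clauses;
* **the time** (`Params.Tpre_le`, `Params.Tpre_real_le`, `Params.N_real_le`, `Params.N_sq_real_le`,
  `exists_sq_le_two_rpow`): the build is polynomial in `Lx`, `N = K 2^{3b}`, `3b`, hence
  `O_K(2^{(δ/2) n})` once `24 c ≤ δ K`, and the emulated run costs `38 f(K) (N^{g(K)} + 1) =
  O_K(2^{(δ/2) n})` by `eventually_forall_clique_time_le` (`a = 3 max(c, 1)`);
* **the named fact** `sparseKSATInRAMTime_of_kCliqueInTimeNLittleOK_holds`, choosing `K` large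
  along the three eventual conditions.

## References

* J. Chen, X. Huang, I. A. Kanj, G. Xia, *Strong computational lower bounds via parameterized
  complexity*, JCSS 72 (2006) 1346–1367, Lemma 2.2 and Thm. 5.5.
* V. Vassilevska Williams, *On some fine-grained questions in algorithms and complexity*,
  Proc. ICM 2018, §2.
-/


namespace Literature.Computability.FineGrained

open Cryptography Cryptography.WordRAM Complexity Cryptography.WordRAM.SProg

namespace CliqueRed

/-- A one-word read-out determines cell `1`. [folklore] -/
theorem mem_one_of_readOut {m : ℕ → ℕ} {b : ℕ} (h : readOut m = [b]) : m 1 = b := by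
  have hl : m 0 = 1 := by simpa using congrArg List.length h
  unfold readOut at h; rw [hl] at h
  simpa [readSeg] using h

/-- `relocated x a` for `a ≥ 2` is an input word or `0`. [folklore] -/
theorem relocated_le_of_forall {x : List ℕ} {B : ℕ} (hx : ∀ v ∈ x, v ≤ B) {a : ℕ} (ha : 2 ≤ a) :
    relocated x a ≤ B := by
  have hg : ∀ i, x.getD i 0 ≤ B := fun i => by
    rw [List.getD_eq_getElem?_getD]
    cases h : x[i]? with
    | none => simp
    | some v => simpa using hx v (List.mem_of_getElem? h)
  unfold relocated
  rw [if_neg (by omega), if_neg (by omega)]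
  split_ifs <;> first | exact hg _ | exact Nat.zero_le _

namespace Params

variable (g : Params) {W : ℕ} {O : List ℕ → List ℕ}

/-- The emulator's side conditions hold for the reduction's layout and environment. [folklore] -/
theorem envOK (hF : g.Fits W) (hK : 2 ≤ g.K) : EnvOK lay g.env W := by
  obtain ⟨hX, hXLx, hV0, hP0, hOK0, hBv, hSv, htop, -⟩ := g.facts hF hK
  refine ⟨by decide, by decide, by decide, by decide, by decide, by decide, by decide,
    fun r hr => ?_, Or.inl ?_, ?_, ?_, hF.ws_lt.le⟩
  · simp only [lay, Layout.regs, List.mem_cons, List.not_mem_nil, or_false] at hr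
    show r < g.Bv ∧ r < g.Sv
    rcases hr with rfl | rfl | rfl | rfl | rfl | rfl | rfl <;> omega
  · show g.Bv + (g.V + 1) ≤ g.Sv; omega
  · show g.Bv + (g.V + 1) ≤ 2 ^ W; omega
  · show g.Sv + (g.V + 1) ≤ 2 ^ W; omega

/-- Every cell of the final memory is below `2 ^ W`. [folklore] -/
theorem finMem_lt (hF : g.Fits W) (hK : 2 ≤ g.K) (a : ℕ) : g.finMem a < 2 ^ W := by
  obtain ⟨hX, hXLx, hV0, hP0, hOK0, hBv, hSv, htop, hNNV, hPwV, -⟩ := g.facts hF hK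
  have hnv := g.numVars_lt hF
  unfold finMem
  by_cases ha : a < 100
  · rw [if_pos ha]; split_ifs <;> omega
  rw [if_neg ha]
  unfold finData
  split_ifs
  · exact lt_of_le_of_lt (relocated_le_of_forall (B := 2 ^ W - 1)
      (fun v hv => Nat.le_sub_one_of_lt (hF.input v hv)) (by omega)) (by omega)
  · exact lt_of_le_of_lt (g.varTab_le _).1 hnv
  · have := (g.varTab_le (a - g.P0)).2; omega
  · have : g.okVal (a - g.OK0) ≤ 1 := Bool.toNat_le _; omega
  · have : g.ycell (a - g.Bv) < g.Pw := by
      unfold ycell; split_ifs <;> exact Nat.mod_lt _ (Nat.two_pow_pos _)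
    omega
  · exact Nat.two_pow_pos W

/-- **The target invariant at the end of the build.** [folklore] -/
theorem tinv_finMem (hF : g.Fits W) (hK : 2 ≤ g.K) : TInv lay g.env (2 ^ W - 1) g.finMem := by
  obtain ⟨hX, hXLx, hV0, hP0, hOK0, hBv, hSv, htop, hNNV, -⟩ := g.facts hF hK
  refine ⟨⟨?_, ?_, ?_, ?_⟩, fun a _ => ?_, fun a => Nat.le_sub_one_of_lt (g.finMem_lt hF hK a)⟩
  · show g.finMem 10 = g.Bv; simp [finMem]
  · show g.finMem 11 = g.Sv; simp [finMem]
  · show g.finMem 12 = 0; simp [finMem]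
  · show g.finMem 13 = 2 ^ g.ws; simp [finMem]; rfl
  · show g.finMem (g.Sv + a) ≤ 0
    unfold finMem finData
    rw [if_neg (by omega), if_neg (by omega), if_neg (by omega), if_neg (by omega),
      if_neg (by omega), if_neg (by omega)]

/-- **The emulated input is in place at the end of the build**: below the region size, the
emulated memory is the initial memory of the clique program on `y` at word size `ws`. [folklore] -/
theorem agree_finMem (hF : g.Fits W) (hK : 2 ≤ g.K) : Agree g.env g.finMem (init g.ws g.y).mem := by
  obtain ⟨hX, hXLx, hV0, hP0, hOK0, hBv, hSv, htop, hNNV, -⟩ := g.facts hF hK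
  have hlen : g.y.length = g.N * g.N + 2 := by
    unfold y; rw [length_kClique_encode_posInstance, ← g.N_eq, sq]
  intro a _
  have hstamp : g.finMem (g.Sv + a) = 0 := by
    unfold finMem finData
    rw [if_neg (by omega), if_neg (by omega), if_neg (by omega), if_neg (by omega),
      if_neg (by omega), if_neg (by omega)]
  show (if g.finMem (g.Sv + a) = 0 then g.finMem (g.Bv + a) else 0) = (init g.ws g.y).mem a
  rw [if_pos hstamp]
  unfold finMem finData
  rw [if_neg (by omega), if_neg (by omega), if_neg (by omega), if_neg (by omega), if_neg (by omega),
    Nat.add_sub_cancel_left]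
  rcases Nat.lt_or_ge a (g.N * g.N + 3) with ha | ha
  · rw [if_pos (by omega)]
    unfold ycell
    rcases Nat.eq_zero_or_pos a with rfl | hpos
    · rw [if_pos rfl, init_mem_zero, hlen]; rfl
    · obtain ⟨j, rfl⟩ := Nat.exists_eq_add_of_le' hpos
      rw [if_neg (by omega), Nat.add_sub_cancel, init_mem_succ _ _ _ (by omega),
        List.getD_eq_getElem _ _ (by omega)]; rfl
  · rw [if_neg (by omega), init_mem_of_length_lt _ _ _ (by omega)]

/-- **The read-out.** From any memory agreeing with the halting memory `dm` of the clique program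
(target invariant kept), `post` outputs `[dm 1]` in `3` steps. [folklore] -/
theorem post_spec (hF : g.Fits W) (hK : 2 ≤ g.K) {m₂ dm : ℕ → ℕ} (hag : Agree g.env m₂ dm)
    (hI : TInv lay g.env (2 ^ W - 1) m₂) (qs : List (List ℕ)) :
    ∃ (st₃ : Store) (t₃ : ℕ), t₃ ≤ 3 ∧ Exec W O post ⟨m₂,
      qs⟩ st₃ t₃ ∧ readOut st₃.mem = [dm 1] := by
  obtain ⟨hX, hXLx, hV0, hP0, hOK0, hBv, hSv, htop, hNNV, -⟩ := g.facts hF hK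
  have h10 : m₂ 10 = g.Bv := hI.env.1
  have hst : m₂ (g.Sv + 1) = 0 := Nat.le_zero.1 (hI.stamp 1 (by show 1 < g.V + 1; omega))
  have h1 : m₂ (g.Bv + 1) = dm 1 := by
    have := hag 1 (by show 1 < g.V + 1; omega)
    simp only [edec, Params.env, hst, if_true] at this
    exact this
  refine ⟨_, 3, le_rfl, Exec.block _ m₂ qs, ?_⟩
  have hm : execOps W m₂ [(.add, r 17, r 10, im 1), (.band, r 1, pt 17, pt 17), (.band, r 0, im 1,
    im 1)] =
      Function.update (Function.update (Function.update m₂ 17 (g.Bv + 1)) 1 (dm 1)) 0 1 := by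
    simp (disch := first | omega | decide) only [execOps_cons, execOps_nil, execOp, Operand.write,
      Operand.read, Function.update_self, Function.update_of_ne, h10, BinOp.eval_add_of_lt,
      BinOp.eval_band, Nat.and_self]
    rw [h1]
  show readOut (execOps W m₂ _) = _
  rw [hm]
  simp [readOut, readSeg, Function.update_self, Function.update_of_ne]

/-- The total time of the reduction program, given a time bound `T` for the clique program.
[folklore] -/
def Ttotal (T : ℕ) : ℕ := g.Tpre + cstep * T + 4

/-- **The reduction program's output.** At a word size `W` with `g.Fits W` (`K ≥ 2`, width `≤ 3`),
if the deterministic oracle-free clique program `M` (largest constant `cM`) outputs `[bit]` on the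
position instance `y` at word size `ws = kM · width` within `T` steps, then the reduction program
outputs `[bit]` on `x = encodeCNFWords φ` within `Tpre + 38 T + 4` steps. [folklore] -/
theorem reduction_outputsWithin (hF : g.Fits W) (hK : 2 ≤ g.K) (hw : g.φ.IsWidthLE 3)
    {M : Program} (hdet : M.IsDeterministic) (hof : M.IsOracleFree) (hcM : M.maxConst = g.cM)
    {T bit : ℕ} (hM : OutputsWithin M g.ws noOracle zeroCoins g.y [bit] T) :
    OutputsWithin (withSubrun (pre g.K g.kM g.cM) lay M post) W noOracle zeroCoins g.x [bit]
      (g.Ttotal T) := by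
  obtain ⟨hX, hXLx, hV0, hP0, hOK0, hBv, hSv, htop, hNNV, hPwV, hcMV, -⟩ := g.facts hF hK
  have hW1 : 1 ≤ W := by have := hF.ws_lt; omega
  have h2W : 2 ≤ 2 ^ W := by
    calc (2 : ℕ) = 2 ^ 1 := rfl
      _ ≤ 2 ^ W := Nat.pow_le_pow_right (by norm_num) hW1
  obtain ⟨st₁, t₁, ht₁, hexec, hmem, hqs⟩ := (g.pre_spec (O := noOracle) hF hK hw).exists_exec
  obtain ⟨dh, hhalt, hout⟩ := (outputsWithin_iff_exists_haltsWithin _ _ _ _ _ _ _).1 hM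
  have hst₁ : st₁ = ⟨g.finMem, []⟩ := by cases st₁; simp only at hmem hqs; rw [hmem, hqs]
  subst hst₁
  have key := outputsWithin_withSubrun (O := noOracle) zeroCoins (pre := pre g.K g.kM g.cM)
    (post := post) (L := lay) (E := g.env) (VT := 2 ^ W - 1) (V := g.V) (M := M) (x := g.x)
    (y := g.y) (out := [bit]) (T₂ := 3) hF.width hexec (g.envOK hF hK) (by omega) (by omega)
    (fun r hr => by
      simp only [lay, Layout.regs, List.mem_cons, List.not_mem_nil, or_false] at hr
      rcases hr with rfl | rfl | rfl | rfl | rfl | rfl | rfl <;> omega)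
    hdet hof (by rw [hcM]; exact hcMV) (by show g.V < g.V + 1; omega) (by omega)
    (by show 2 ^ g.ws - 1 ≤ g.V; have := g.le_V; unfold Pw at this; omega) (by omega)
    (g.tinv_finMem hF hK) (g.agree_finMem hF hK) hhalt
    (fun m₂ hag hI _ => by
      have := g.post_spec (O := noOracle) hF hK hag hI []
      rwa [mem_one_of_readOut hout] at this)
  exact key.mono (by unfold Ttotal; omega)

end Params

end CliqueRed

end Literature.Computability.FineGrained

namespace Literature.Computability.FineGrained

open Cryptography Cryptography.WordRAM Complexity Cryptography.WordRAM.SProg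

namespace CliqueRed

/-! ### Small arithmetic helpers -/

/-- Bounds of the shape `a · 2^e` compose additively. [folklore] -/
theorem add_le_mul_two_pow {x y a b e : ℕ} (hx : x ≤ a * 2 ^ e) (hy : y ≤ b * 2 ^ e) :
    x + y ≤ (a + b) * 2 ^ e := by rw [Nat.add_mul]; exact Nat.add_le_add hx hy

/-- Raising the exponent of a bound `a · 2^t`. [folklore] -/
theorem le_mul_two_pow_of_le {x a t e : ℕ} (hx : x ≤ a * 2 ^ t) (ht : t ≤ e) : x ≤ a * 2 ^ e :=
  hx.trans (Nat.mul_le_mul_left _ (Nat.pow_le_pow_right (by norm_num) ht))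

/-- A constant is a bound of the shape `a · 2^e`. [folklore] -/
theorem le_self_mul_two_pow (a e : ℕ) : a ≤ a * 2 ^ e := Nat.le_mul_of_pos_right _ (Nat.two_pow_pos e)

/-- `a · 2^e ≤ 2^(size a + e)`. [folklore] -/
theorem mul_two_pow_le_two_pow_size_add (a e : ℕ) : a * 2 ^ e ≤ 2 ^ (Nat.size a + e) := by
  rw [Nat.pow_add]; exact Nat.mul_le_mul_right _ (Nat.lt_size_self a).le

/-- `Nat.size` is at most the number itself. [folklore] -/
theorem size_le_self (x : ℕ) : Nat.size x ≤ x := Nat.size_le.2 Nat.lt_two_pow_self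

/-- The total size of a CNF of width `≤ 3` is at most `3 m`. [folklore] -/
theorem size_le_three_mul {φ : CNF ℕ} (hw : φ.IsWidthLE 3) : CNF.size φ ≤ 3 * φ.length := by
  unfold CNF.size
  induction φ with
  | nil => simp
  | cons c φ ih =>
    simp only [List.map_cons, List.sum_cons, List.length_cons]
    have h1 := hw c (by simp)
    have h2 := ih (fun d hd => hw d (by simp [hd]))
    omega

namespace Params

variable (g : Params)

/-- `b ≤ m` (for `K ≥ 1`). [folklore] -/
theorem b_le_m (hK : 1 ≤ g.K) : g.b ≤ g.m := by
  unfold b blockLen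
  rcases Nat.eq_zero_or_pos g.m with h | h
  · rw [h, Nat.zero_add, Nat.div_eq_of_lt (by omega)]
  · apply Nat.div_le_of_le_mul
    have h1 := Nat.mul_le_mul_left (g.K - 1) h
    have h2 : g.m ≤ g.K * g.m := Nat.le_mul_of_pos_left _ hK
    rw [Nat.mul_one, Nat.sub_one_mul] at h1
    omega

/-- `Lx = 2 + m + size ≤ 2 + 4 m` for width `≤ 3`. [folklore] -/
theorem Lx_le (hw : g.φ.IsWidthLE 3) : g.Lx ≤ 2 + 4 * g.m := by
  have := size_le_three_mul hw
  unfold Lx x m at *; rw [length_encodeCNFWords_eq, CNF.numClauses]; omega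

/-- **The running time of the build**, polynomially in `Lx`, `N`, `3b`. [folklore] -/
theorem Tpre_le (hK : 2 ≤ g.K) : g.Tpre ≤ 300 * (g.Lx + g.N * g.N * (g.B3 * g.B3 + 1) + 1) := by
  have hN : 2 ≤ g.N := le_trans hK g.K_le_N
  have hσ : Nat.size (g.N * g.N + 2) ≤ g.N * g.N + 2 := size_le_self _
  have hm : g.m ≤ g.Lx := by have := g.m_add_two_le_Lx; omega
  have hb : 3 * g.b = g.B3 := rfl
  have h1 : g.N ≤ g.N * g.N := Nat.le_mul_self _
  have h2 : g.B3 ≤ g.B3 * g.B3 := Nat.le_mul_self _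
  unfold Tpre Tok Trow Tentry Tconf Tgood
  have h3 : g.N * (g.B3 * (26 * g.B3 + 7) + 4 + (g.b * 65 + 4) + 10 + 2) ≤
      g.N * g.N * (55 * (g.B3 * g.B3) + 20) := by
    have : g.B3 * (26 * g.B3 + 7) + 4 + (g.b * 65 + 4) + 10 + 2 ≤ 55 * (g.B3 * g.B3) + 20 := by
      nlinarith
    calc _ ≤ g.N * (55 * (g.B3 * g.B3) + 20) := Nat.mul_le_mul_left _ this
      _ ≤ g.N * g.N * (55 * (g.B3 * g.B3) + 20) := Nat.mul_le_mul_right _ h1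
  have h4 : g.N * (g.N * (g.B3 * (26 * g.B3 + 7) + 4 + 23 + 2) + 5 + 2) ≤
      g.N * g.N * (33 * (g.B3 * g.B3) + 36) := by
    have h5 : g.B3 * (26 * g.B3 + 7) + 4 + 23 + 2 ≤ 33 * (g.B3 * g.B3) + 29 := by nlinarith
    calc _ ≤ g.N * (g.N * (33 * (g.B3 * g.B3) + 29) + 7) :=
          Nat.mul_le_mul_left _ (by have := Nat.mul_le_mul_left g.N h5; omega)
      _ = g.N * g.N * (33 * (g.B3 * g.B3) + 29) + g.N * 7 := by ring
      _ ≤ g.N * g.N * (33 * (g.B3 * g.B3) + 29) + g.N * g.N * 7 := by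
          have := Nat.mul_le_mul_right 7 h1; omega
      _ = g.N * g.N * (33 * (g.B3 * g.B3) + 36) := by ring
  have h6 : g.N * g.N ≤ g.N * g.N * (g.B3 * g.B3 + 1) := Nat.le_mul_of_pos_right _ (by omega)
  have h7 : g.N * g.N * (g.B3 * g.B3) ≤ g.N * g.N * (g.B3 * g.B3 + 1) := Nat.mul_le_mul_left _ (by omega)
  nlinarith [h3, h4, h6, h7, hσ, hm]

/-! ### The word-size constant -/

/-- **The word-size constant** of the reduction: with `W = kfit · (n + inputWidth x)` every
address and value of the run fits (`fits`). [folklore] -/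
def kfit (K kM cM c : ℕ) : ℕ :=
  Nat.size (2 * (K * K) + 3 * K + 2 * cM + 111) + kM * Nat.size (K * K + 2) + 6 * c * (kM + 1) + 2

/-- **The word size fits.** For a formula with `m ≤ c n` clauses and `K ≥ 2`, the run at word size
`kfit · (n + inputWidth x)` satisfies `Fits`. [folklore] -/
theorem fits (hK : 2 ≤ g.K) {c : ℕ} (hc : g.m ≤ c * g.φ.numVars) :
    g.Fits (kfit g.K g.kM g.cM c * (g.φ.numVars + inputWidth g.x)) := by
  -- notation
  set n := g.φ.numVars with hn
  set w := inputWidth g.x with hw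
  set A := 2 * (g.K * g.K) + 3 * g.K + 2 * g.cM + 111 with hA
  set cn := c * n with hcn
  set sK := Nat.size (g.K * g.K + 2) with hsK
  have hw1 : 1 ≤ w := inputWidth_pos _
  have hLx : g.Lx < 2 ^ w := length_lt_two_pow_inputWidth _
  obtain ⟨hX, hV0, hP0, hOK0, hBv, hSv⟩ := g.bases
  have hbm : g.b ≤ g.m := g.b_le_m (by omega)
  have hB3 : g.B3 ≤ 3 * cn := by unfold B3; omega
  -- N ≤ K 2^{3cn}
  have hN : g.N ≤ g.K * 2 ^ (3 * cn) :=
    Nat.mul_le_mul_left _ (Nat.pow_le_pow_right Nat.two_pos hB3)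
  have hNN : g.N * g.N + 2 ≤ (g.K * g.K + 2) * 2 ^ (6 * cn) := by
    have h1 : g.N * g.N ≤ g.K * g.K * 2 ^ (6 * cn) := by
      have hp : 2 ^ (6 * cn) = 2 ^ (3 * cn) * 2 ^ (3 * cn) := by
        rw [← Nat.pow_add]; congr 1; ring
      calc g.N * g.N ≤ (g.K * 2 ^ (3 * cn)) * (g.K * 2 ^ (3 * cn)) := Nat.mul_le_mul hN hN
        _ = g.K * g.K * 2 ^ (6 * cn) := by rw [hp]; ring
    exact add_le_mul_two_pow h1 (by have := Nat.one_le_two_pow (n := 6 * cn); omega)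
  -- σ, ws
  have hσ : Nat.size (g.N * g.N + 2) ≤ sK + 6 * cn := by
    have := Nat.size_le_size hNN
    rwa [← Nat.shiftLeft_eq, Nat.size_shiftLeft (by positivity)] at this
  have hws : g.ws ≤ g.kM * sK + 6 * (g.kM * cn) := by
    have : g.ws ≤ g.kM * (sK + 6 * cn) := Nat.mul_le_mul_left _ hσ
    have e : g.kM * (sK + 6 * cn) = g.kM * sK + 6 * (g.kM * cn) := by ring
    omega
  -- the exponent
  set E := w + 6 * cn + g.ws with hE
  have h2E : ∀ t, t ≤ E → 2 ^ t ≤ 2 ^ E := fun t ht => Nat.pow_le_pow_right Nat.two_pos ht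
  have hV : g.V ≤ 2 ^ g.ws + g.cM + (g.K * g.K + 2) * 2 ^ (6 * cn) := by
    unfold V Pw; have := Nat.one_le_two_pow (n := g.ws); omega
  have hBvle : g.Bv ≤ (3 * g.K + 103) * 2 ^ E := by
    have e1 : 2 * g.Lx ≤ 2 * 2 ^ E := by have := h2E w (by omega); omega
    have e2 : 101 ≤ 101 * 2 ^ E := le_self_mul_two_pow _ _
    have e3 : 2 * (g.B3 * g.K) ≤ 2 * g.K * 2 ^ E := by
      have : g.B3 ≤ 2 ^ (3 * cn) := hB3.trans Nat.lt_two_pow_self.le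
      calc 2 * (g.B3 * g.K) ≤ 2 * (2 ^ (3 * cn) * g.K) := by gcongr
        _ = 2 * g.K * 2 ^ (3 * cn) := by ring
        _ ≤ 2 * g.K * 2 ^ E := Nat.mul_le_mul_left _ (h2E _ (by omega))
    have e4 : g.N ≤ g.K * 2 ^ E := hN.trans (Nat.mul_le_mul_left _ (h2E _ (by omega)))
    have : g.Bv = 2 * g.Lx + 101 + 2 * (g.B3 * g.K) + g.N := by
      rw [← hBv, ← hOK0, ← hP0, ← hV0]; unfold X; ring
    rw [this, show 3 * g.K + 103 = 2 + 101 + 2 * g.K + g.K by ring]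
    exact add_le_mul_two_pow (add_le_mul_two_pow (add_le_mul_two_pow e1 e2) e3) e4
  have hVle : 2 * g.V + 2 ≤ (2 * (g.K * g.K) + 2 * g.cM + 8) * 2 ^ E := by
    have e1 : 2 * 2 ^ g.ws ≤ 2 * 2 ^ E := Nat.mul_le_mul_left _ (h2E _ (by omega))
    have e2 : 2 * g.cM ≤ 2 * g.cM * 2 ^ E := le_self_mul_two_pow _ _
    have e3 : 2 * ((g.K * g.K + 2) * 2 ^ (6 * cn)) ≤ 2 * (g.K * g.K + 2) * 2 ^ E := by
      rw [Nat.mul_assoc]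
      exact Nat.mul_le_mul_left _ (Nat.mul_le_mul_left _ (h2E _ (by omega)))
    have e4 : 2 ≤ 2 * 2 ^ E := le_self_mul_two_pow _ _
    have h := add_le_mul_two_pow (add_le_mul_two_pow (add_le_mul_two_pow e1 e2) e3) e4
    rw [show 2 + 2 * g.cM + 2 * (g.K * g.K + 2) + 2 = 2 * (g.K * g.K) + 2 * g.cM + 8 by ring] at h
    omega
  have htot : g.Sv + g.V + 1 ≤ 2 ^ (Nat.size A + E) := by
    have h := add_le_mul_two_pow hBvle hVle
    rw [show 3 * g.K + 103 + (2 * (g.K * g.K) + 2 * g.cM + 8) = A by rw [hA]; ring] at h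
    exact le_trans (by omega) (h.trans (mul_two_pow_le_two_pow_size_add A E))
  -- the word size
  set sA := Nat.size A with hsA
  have hkfit : kfit g.K g.kM g.cM c = sA + g.kM * sK + 6 * c * (g.kM + 1) + 2 := rfl
  set t6 := 6 * c * (g.kM + 1) with ht6
  have hkn : t6 * n = 6 * (g.kM * cn) + 6 * cn := by rw [ht6, hcn]; ring
  have hW : sA + E + 1 ≤ kfit g.K g.kM g.cM c * (n + w) := by
    rw [hkfit, Nat.mul_add]
    have h1 : t6 * n ≤ (sA + g.kM * sK + t6 + 2) * n := Nat.mul_le_mul_right _ (by omega)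
    have h2 : (sA + g.kM * sK + 1 + 1) * w ≤ (sA + g.kM * sK + t6 + 2) * w :=
      Nat.mul_le_mul_right _ (by omega)
    have h3 : (sA + g.kM * sK + 1) + w ≤ (sA + g.kM * sK + 1 + 1) * w := by
      rw [Nat.add_mul _ 1 w, Nat.one_mul]
      exact Nat.add_le_add_right (Nat.le_mul_of_pos_right _ hw1) _
    omega
  refine ⟨htot.trans (Nat.pow_le_pow_right Nat.two_pos (by omega)), by omega, ?_⟩
  calc w ≤ 1 * (n + w) := by omega
    _ ≤ kfit g.K g.kM g.cM c * (n + w) := Nat.mul_le_mul_right _ (by rw [hkfit]; omega)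

end Params

end CliqueRed

end Literature.Computability.FineGrained

namespace Literature.Computability.FineGrained

open Filter Topology Cryptography Cryptography.WordRAM Complexity Cryptography.WordRAM.SProg

namespace CliqueRed

/-- Squares are dominated by every exponential: `(n + 1)² ≤ C · 2^{ε n}`. [folklore] -/
theorem exists_sq_le_two_rpow {ε : ℝ} (hε : 0 < ε) :
    ∃ C : ℝ, 0 ≤ C ∧ ∀ n : ℕ, ((n : ℝ) + 1) ^ 2 ≤ C * (2 : ℝ) ^ (ε * n) := by
  set r : ℝ := (2 : ℝ) ^ ε with hr
  have hr1 : 1 < r := Real.one_lt_rpow (by norm_num) hε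
  have hr0 : 0 < r := by linarith
  have ht := tendsto_pow_const_div_const_pow_of_one_lt 2 hr1
  obtain ⟨B, hB⟩ := ht.bddAbove_range
  have hBn : ∀ n : ℕ, (n : ℝ) ^ 2 / r ^ n ≤ B := fun n => hB ⟨n, rfl⟩
  have hB0 : 0 ≤ B := le_trans (by positivity) (hBn 0)
  refine ⟨2 * B + 2, by positivity, fun n => ?_⟩
  have hrn : 0 < r ^ n := pow_pos hr0 n
  have hrn1 : 1 ≤ r ^ n := one_le_pow₀ hr1.le
  have h1 : (n : ℝ) ^ 2 ≤ B * r ^ n := by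
    have := hBn n; rwa [div_le_iff₀ hrn] at this
  have h2 : (2 : ℝ) ^ (ε * n) = r ^ n := by rw [hr, Real.rpow_mul_natCast (by norm_num)]
  rw [h2]
  have hn0 : (0 : ℝ) ≤ n := Nat.cast_nonneg _
  nlinarith [h1, hrn1, sq_nonneg ((n : ℝ) - 1)]

namespace Params

variable (g : Params)

/-- The vertex number in real terms: `N ≤ K · 2^{3c'(n/K + 1)}` with `c' = max c 1`, for
`m ≤ c n`. [folklore] -/
theorem N_real_le (hK : 1 ≤ g.K) {c : ℕ} (hc : g.m ≤ c * g.φ.numVars) :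
    (g.N : ℝ) ≤ g.K * (2 : ℝ) ^ (3 * max (c : ℝ) 1 * ((g.φ.numVars : ℝ) / g.K + 1)) := by
  set n := g.φ.numVars
  have hb : g.b ≤ c * n / g.K + 1 := blockLen_le_of_sparse hK hc
  have hbR : (g.b : ℝ) ≤ (c : ℝ) * n / g.K + 1 := by
    calc (g.b : ℝ) ≤ ((c * n / g.K : ℕ) : ℝ) + 1 := by exact_mod_cast hb
      _ ≤ (c : ℝ) * n / g.K + 1 := by
          gcongr; simpa [Nat.cast_mul] using Nat.cast_div_le (m := c * n) (n := g.K) (α := ℝ)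
  have hK0 : (0 : ℝ) < g.K := by exact_mod_cast hK
  have hc' : (c : ℝ) ≤ max (c : ℝ) 1 := le_max_left _ _
  have h1' : (1 : ℝ) ≤ max (c : ℝ) 1 := le_max_right _ _
  have hn0 : (0 : ℝ) ≤ (n : ℝ) / g.K := by positivity
  have hexp : ((g.B3 : ℕ) : ℝ) ≤ 3 * max (c : ℝ) 1 * ((n : ℝ) / g.K + 1) := by
    have : (g.B3 : ℝ) = 3 * g.b := by unfold B3; push_cast; ring
    rw [this]
    calc (3 : ℝ) * g.b ≤ 3 * ((c : ℝ) * n / g.K + 1) := by gcongr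
      _ = 3 * ((c : ℝ) * ((n : ℝ) / g.K) + 1) := by ring
      _ ≤ 3 * (max (c : ℝ) 1 * ((n : ℝ) / g.K) + max (c : ℝ) 1 * 1) := by gcongr; linarith
      _ = 3 * max (c : ℝ) 1 * ((n : ℝ) / g.K + 1) := by ring
  have hN : (g.N : ℝ) = g.K * (2 : ℝ) ^ ((g.B3 : ℕ) : ℝ) := by
    unfold N S; push_cast; rw [Real.rpow_natCast]
  rw [hN]
  exact mul_le_mul_of_nonneg_left (Real.rpow_le_rpow_of_exponent_le one_le_two hexp) (by positivity)

/-- The square of the vertex number: `N² ≤ 64 K² 2^{(δ/4) n}` once `24 c ≤ δ K`. [folklore] -/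
theorem N_sq_real_le (hK : 1 ≤ g.K) {c : ℕ} (hc : g.m ≤ c * g.φ.numVars) {δ : ℝ}
    (hKδ : 24 * (c : ℝ) ≤ δ * g.K) :
    ((g.N : ℝ)) ^ 2 ≤ 64 * (g.K : ℝ) ^ 2 * (2 : ℝ) ^ (δ / 4 * g.φ.numVars) := by
  set n := g.φ.numVars
  have hb : g.b ≤ c * n / g.K + 1 := blockLen_le_of_sparse hK hc
  have hbR : (g.b : ℝ) ≤ (c : ℝ) * n / g.K + 1 := by
    calc (g.b : ℝ) ≤ ((c * n / g.K : ℕ) : ℝ) + 1 := by exact_mod_cast hb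
      _ ≤ (c : ℝ) * n / g.K + 1 := by
          gcongr; simpa [Nat.cast_mul] using Nat.cast_div_le (m := c * n) (n := g.K) (α := ℝ)
  have hK0 : (0 : ℝ) < g.K := by exact_mod_cast hK
  have hn0 : (0 : ℝ) ≤ n := Nat.cast_nonneg _
  have hN : (g.N : ℝ) ^ 2 = (g.K : ℝ) ^ 2 * (2 : ℝ) ^ ((6 * g.b : ℕ) : ℝ) := by
    rw [Real.rpow_natCast]; unfold N S B3; push_cast; ring
  have hexp : ((6 * g.b : ℕ) : ℝ) ≤ 6 + δ / 4 * n := by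
    push_cast
    have h1 : (6 : ℝ) * g.b ≤ 6 * ((c : ℝ) * n / g.K) + 6 := by nlinarith
    have h2 : 6 * ((c : ℝ) * n / g.K) ≤ δ / 4 * n := by
      rw [show 6 * ((c : ℝ) * n / g.K) = (24 * c) / g.K * n / 4 by field_simp; ring]
      have : (24 * (c : ℝ)) / g.K ≤ δ := by rw [div_le_iff₀ hK0]; linarith
      nlinarith
    linarith
  rw [hN]
  calc (g.K : ℝ) ^ 2 * (2 : ℝ) ^ ((6 * g.b : ℕ) : ℝ) ≤ (g.K : ℝ) ^ 2 * (2 : ℝ) ^ (6 + δ / 4 * n) :=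
        mul_le_mul_of_nonneg_left (Real.rpow_le_rpow_of_exponent_le one_le_two hexp) (by positivity)
    _ = 64 * (g.K : ℝ) ^ 2 * (2 : ℝ) ^ (δ / 4 * n) := by
        rw [Real.rpow_add (by norm_num), show (2 : ℝ) ^ (6 : ℝ) = 64 by norm_num]; ring

/-- **The running time of the reduction in real terms**: for `K ≥ 2`, `24 c ≤ δ K`, width `≤ 3`
and `m ≤ c n`, the build plus read-out costs at most `C_b · 2^{(δ/2) n}` for an explicit
`C_b = C_b(K, c, C₃)`, given the polynomial-vs-exponential constant `C₃` of exponent `δ/4`.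
[folklore] -/
theorem Tpre_real_le (hK : 2 ≤ g.K) (hw : g.φ.IsWidthLE 3) {c : ℕ} (hc : g.m ≤ c * g.φ.numVars)
    {δ : ℝ} (hδ : 0 < δ) (hKδ : 24 * (c : ℝ) ≤ δ * g.K) {C₃ : ℝ} (hC₃ : 0 ≤ C₃)
    (hpoly : ∀ n : ℕ, ((n : ℝ) + 1) ^ 2 ≤ C₃ * (2 : ℝ) ^ (δ / 4 * n)) :
    (g.Tpre : ℝ) + 4 ≤ (300 * ((4 * c + 3) * C₃ + 640 * (g.K : ℝ) ^ 2 * ((c : ℝ) + 1) ^ 2 * C₃) + 4) *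
      (2 : ℝ) ^ (δ / 2 * g.φ.numVars) := by
  set n := g.φ.numVars
  have hn0 : (0 : ℝ) ≤ n := Nat.cast_nonneg _
  have hT := g.Tpre_le hK
  have hLx : g.Lx ≤ 2 + 4 * g.m := g.Lx_le hw
  have hb : g.b ≤ c * n / g.K + 1 := blockLen_le_of_sparse (by omega) hc
  have hbn : g.b ≤ c * n + 1 := hb.trans (Nat.add_le_add_right (Nat.div_le_self _ _) 1)
  -- real forms
  have e1 : (0 : ℝ) < (2 : ℝ) ^ (δ / 4 * n) := by positivity
  have e2 : (1 : ℝ) ≤ (2 : ℝ) ^ (δ / 4 * n) := Real.one_le_rpow (by norm_num) (by positivity)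
  have e3 : (2 : ℝ) ^ (δ / 4 * n) ≤ (2 : ℝ) ^ (δ / 2 * n) :=
    Real.rpow_le_rpow_of_exponent_le one_le_two (by nlinarith)
  have e4 : (2 : ℝ) ^ (δ / 4 * n) * (2 : ℝ) ^ (δ / 4 * n) = (2 : ℝ) ^ (δ / 2 * n) := by
    rw [← Real.rpow_add (by norm_num)]; ring_nf
  have hpn := hpoly n
  have hNsq := g.N_sq_real_le (by omega) hc hKδ
  -- casts of the natural bounds
  have cT : (g.Tpre : ℝ) ≤ 300 * ((g.Lx : ℝ) + (g.N : ℝ) ^ 2 * ((g.B3 : ℝ) ^ 2 + 1) + 1) := by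
    have : ((g.Tpre : ℕ) : ℝ) ≤ ((300 * (g.Lx + g.N * g.N * (g.B3 * g.B3 + 1) + 1) : ℕ) : ℝ) := by
      exact_mod_cast hT
    simpa [sq, Nat.cast_mul, Nat.cast_add, Nat.cast_pow] using this
  have cLx : (g.Lx : ℝ) + 1 ≤ (4 * c + 3) * ((n : ℝ) + 1) ^ 2 := by
    have h1 : (g.Lx : ℝ) ≤ 2 + 4 * (c * n) := by
      have : ((g.Lx : ℕ) : ℝ) ≤ ((2 + 4 * g.m : ℕ) : ℝ) := by exact_mod_cast hLx
      have hm : ((g.m : ℕ) : ℝ) ≤ ((c * n : ℕ) : ℝ) := by exact_mod_cast hc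
      push_cast at this hm; linarith
    nlinarith [sq_nonneg (n : ℝ)]
  have cB3 : (g.B3 : ℝ) ^ 2 + 1 ≤ 10 * ((c : ℝ) + 1) ^ 2 * ((n : ℝ) + 1) ^ 2 := by
    have h1 : (g.B3 : ℝ) ≤ 3 * (c * n) + 3 := by
      have : ((g.B3 : ℕ) : ℝ) = 3 * g.b := by unfold B3; push_cast; ring
      have hb' : ((g.b : ℕ) : ℝ) ≤ ((c * n + 1 : ℕ) : ℝ) := by exact_mod_cast hbn
      push_cast at hb'; rw [this]; linarith
    have h0 : (0 : ℝ) ≤ g.B3 := Nat.cast_nonneg _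
    nlinarith [sq_nonneg (n : ℝ), sq_nonneg (c : ℝ), mul_nonneg hn0 (Nat.cast_nonneg c)]
  -- assemble
  have hA : (g.Lx : ℝ) + 1 ≤ (4 * c + 3) * C₃ * (2 : ℝ) ^ (δ / 2 * n) := by
    calc (g.Lx : ℝ) + 1 ≤ (4 * c + 3) * ((n : ℝ) + 1) ^ 2 := cLx
      _ ≤ (4 * c + 3) * (C₃ * (2 : ℝ) ^ (δ / 4 * n)) := by gcongr
      _ ≤ (4 * c + 3) * (C₃ * (2 : ℝ) ^ (δ / 2 * n)) := by gcongr
      _ = _ := by ring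
  have hB : (g.N : ℝ) ^ 2 * ((g.B3 : ℝ) ^ 2 + 1) ≤
      640 * (g.K : ℝ) ^ 2 * ((c : ℝ) + 1) ^ 2 * C₃ * (2 : ℝ) ^ (δ / 2 * n) := by
    calc (g.N : ℝ) ^ 2 * ((g.B3 : ℝ) ^ 2 + 1)
        ≤ (64 * (g.K : ℝ) ^ 2 * (2 : ℝ) ^ (δ / 4 * n)) * (10 * ((c : ℝ) + 1) ^ 2 * ((n : ℝ) + 1) ^ 2) := by
          gcongr
      _ ≤ (64 * (g.K : ℝ) ^ 2 * (2 : ℝ) ^ (δ / 4 * n)) * (10 * ((c : ℝ) + 1) ^ 2 * (C₃ * (2 : ℝ) ^ (δ / 4 * n))) := by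
          gcongr
      _ = 640 * (g.K : ℝ) ^ 2 * ((c : ℝ) + 1) ^ 2 * C₃ * ((2 : ℝ) ^ (δ / 4 * n) * (2 : ℝ) ^ (δ / 4 * n)) := by
          ring
      _ = _ := by rw [e4]
  have h4 : (4 : ℝ) ≤ 4 * (2 : ℝ) ^ (δ / 2 * n) := by nlinarith
  calc (g.Tpre : ℝ) + 4 ≤ 300 * ((g.Lx : ℝ) + (g.N : ℝ) ^ 2 * ((g.B3 : ℝ) ^ 2 + 1) + 1) + 4 := by linarith
    _ = 300 * (((g.Lx : ℝ) + 1) + (g.N : ℝ) ^ 2 * ((g.B3 : ℝ) ^ 2 + 1)) + 4 := by ring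
    _ ≤ 300 * ((4 * c + 3) * C₃ * (2 : ℝ) ^ (δ / 2 * n) +
          640 * (g.K : ℝ) ^ 2 * ((c : ℝ) + 1) ^ 2 * C₃ * (2 : ℝ) ^ (δ / 2 * n)) + 4 * (2 : ℝ) ^ (δ / 2 * n) := by
        gcongr
    _ = _ := by ring

end Params

/-! ### The named fact -/

open scoped Classical in
/-- Accepted outputs of `kSATProblem 3`: `[1]` iff satisfiable. [folklore] -/
theorem kSATProblem_good (φ : (kSATProblem 3).Inst) (out : List ℕ) :
    out ∈ (kSATProblem 3).Good φ ↔ out = [if φ.1.Satisfiable then 1 else 0] := by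
  change out ∈ CNFSAT.Good φ.1 ↔ _
  rw [CNFSAT_good_iff]

/-- **Chen–Huang–Kanj–Xia, the grouping reduction on the word RAM (proof of the named fact
`sparseKSATInRAMTime_of_kCliqueInTimeNLittleOK`).** If `k`-Clique has an `f(k) · N^{o(k)}`-time
word-RAM algorithm, then for every density `c` and every `δ > 0`, sparse 3-SAT (`m ≤ c n`) is in
word-RAM time `O(2^{δ n})`: choose `K` with `g(K)/K` small (`eventually_forall_clique_time_le`,
`a = 3 max(c,1)`, target `δ/2`), `24 c ≤ δ K` and `K ≥ 2`; run the reduction program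
(`reduction_outputsWithin`) — relocation, slot tables, vertex table, adjacency matrix of the
position instance (`hasKClique_posInstance_iff`), one emulated run of the clique program, read-out —
at word size `kfit · (n + width)`; the build costs `O_K(2^{(δ/2) n})` (`Tpre_real_le`) and the
emulated run `38 f(K) (N^{g(K)} + 1) = O_K(2^{(δ/2) n})`. [cite: ChenHuangKanjXiaJCSS2006,
Lemma 2.2 and Thm. 5.5] -/
theorem _root_.Literature.Computability.FineGrained.sparseKSATInRAMTime_of_kCliqueInTimeNLittleOK_holds :
    sparseKSATInRAMTime_of_kCliqueInTimeNLittleOK := by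
  classical
  rintro ⟨f, gexp, hg, M, kM, hdet, hof, hM⟩ c δ hδ
  -- the choice of `K`
  have hδ2 : 0 < δ / 2 := by linarith
  have hδ4 : 0 < δ / 4 := by linarith
  have ha : (0 : ℝ) ≤ 3 * max (c : ℝ) 1 := by positivity
  have E1 := eventually_forall_clique_time_le f hg ha hδ2
  have E2 : ∀ᶠ K : ℕ in atTop, 24 * (c : ℝ) ≤ δ * K := by
    have := tendsto_natCast_atTop_atTop (R := ℝ) |>.eventually_ge_atTop (24 * (c : ℝ) / δ)
    filter_upwards [this] with K hK
    rw [div_le_iff₀ hδ] at hK; linarith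
  have E3 : ∀ᶠ K : ℕ in atTop, 2 ≤ K := eventually_ge_atTop 2
  obtain ⟨K, ⟨C₁, hC₁, hrun⟩, hKδ, hK2⟩ := (E1.and (E2.and E3)).exists
  obtain ⟨C₃, hC₃, hpoly⟩ := exists_sq_le_two_rpow hδ4
  -- the program and the constants
  set cM := M.maxConst with hcM
  set Cb : ℝ := 300 * ((4 * c + 3) * C₃ + 640 * (K : ℝ) ^ 2 * ((c : ℝ) + 1) ^ 2 * C₃) + 4 with hCb
  have hCb0 : 0 ≤ Cb := by positivity
  refine ⟨reduction M K kM, Params.kfit K kM cM c, Cb + 38 * C₁, reduction_isDeterministic M K kM,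
    reduction_isOracleFree M K kM, fun φ hsparse => ?_⟩
  -- one instance
  obtain ⟨hw3, -⟩ := φ.2
  set g : Params := ⟨φ.1, K, kM, cM⟩ with hgdef
  have hsize : (kSATProblem 3).size φ = g.φ.numVars := rfl
  have hwidth : (kSATProblem 3).width φ = inputWidth g.x := rfl
  have henc : (kSATProblem 3).encode φ = g.x := rfl
  rw [hsize] at hsparse ⊢
  rw [hwidth, henc]
  have hc : g.m ≤ c * g.φ.numVars := hsparse
  have hK : 2 ≤ g.K := hK2
  have hF := g.fits hK hc
  -- the clique program on the position instance
  obtain ⟨out, hout, hMrun⟩ := hM (posInstance g.φ g.K)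
  rw [kClique_good_posInstance hK hw3, Set.mem_singleton_iff] at hout
  subst hout
  have hws : kM * kClique.width (posInstance g.φ g.K) = g.ws := by
    rw [kClique_width_posInstance, ← g.N_eq, sq]; rfl
  rw [hws] at hMrun
  have hred := g.reduction_outputsWithin hF hK hw3 hdet hof rfl hMrun
  refine ⟨_, (kSATProblem_good φ _).2 rfl, hred.mono ?_⟩
  -- the time bound
  set n := g.φ.numVars
  apply Nat.le_floor
  have hpos : (0 : ℝ) < (2 : ℝ) ^ (δ * n) := by positivity
  have hn0 : (0 : ℝ) ≤ n := Nat.cast_nonneg _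
  have hhalf : (2 : ℝ) ^ (δ / 2 * n) ≤ (2 : ℝ) ^ (δ * n) :=
    Real.rpow_le_rpow_of_exponent_le one_le_two (by nlinarith)
  have hN : ((posInstance g.φ g.K).n : ℝ) ≤ K * (2 : ℝ) ^ (3 * max (c : ℝ) 1 * ((n : ℝ) / K + 1)) := by
    rw [← g.N_eq]; exact g.N_real_le (by omega) hc
  have hT := hrun n (posInstance g.φ g.K).n hN
  have hB := g.Tpre_real_le hK hw3 hc hδ hKδ hC₃ hpoly
  unfold Params.Ttotal
  push_cast
  have hcs : (cstep : ℝ) = 38 := by norm_num [cstep]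
  rw [hcs]
  calc (g.Tpre : ℝ) + 38 * ((f K : ℝ) * ((⌊((posInstance g.φ g.K).n : ℝ) ^ gexp K⌋₊ : ℝ) + 1)) + 4
      ≤ Cb * (2 : ℝ) ^ (δ / 2 * n) + 38 * (C₁ * (2 : ℝ) ^ (δ / 2 * n)) := by linarith
    _ ≤ Cb * (2 : ℝ) ^ (δ * n) + 38 * (C₁ * (2 : ℝ) ^ (δ * n)) := by gcongr
    _ = (Cb + 38 * C₁) * (2 : ℝ) ^ (δ * n) := by ring
    _ ≤ (Cb + 38 * C₁) * (2 : ℝ) ^ (δ * n) + (Cb + 38 * C₁) := by linarith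

end CliqueRed

end Literature.Computability.FineGrained

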